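import Literature.AlgebraicGeometry.Resolution.AffineBlowupAlgebra
import Mathlib.RingTheory.MvPolynomial.Basic
import Mathlib.RingTheory.Ideal.Quotient.Operations
import Mathlib.RingTheory.Localization.Away.Basic
import HarnessLib

/-!
# The `z`-chart of `Bl_𝔪(E₈⁰)` misses the exceptional divisor

Support file for crux stmt-ResolutionOfSingularities-15315
(`FrobeniusLadder.FInjectiveMacaulayfication`, line `Sketch`, lead seat c4, cycle 5, wave 2):
stub `stub_e8ChartZUnit` of the §7 CALIBRATION package (the blowing up `Bl_𝔪 E₈⁰` of the
rational double point `E₈⁰ : z² + x³ + y⁵ = 0` in characteristic `5`, fed through the blow-up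
glue E6′).

Let `k` be a field, `f = z² + x³ + y⁵ ∈ k[x, y, z]` (`X 0 = x`, `X 1 = y`, `X 2 = z`),
`R = k[x, y, z]/(f)` and `𝔪 = (x̄, ȳ, z̄) ⊆ R`. The blowing up `Bl_𝔪(Spec R) = Proj R[𝔪t]` is
covered by the three charts `D₊(x̄t), D₊(ȳt), D₊(z̄t)`; the coordinate ring of the `z`-chart is
`A_z = (R[𝔪t])_{(z̄t)} = HomogeneousLocalization.Away (reesGrading 𝔪) (reesT z̄ _)`, Stacks'
affine blowup algebra `R[𝔪/z̄]`, in which the exceptional divisor is cut out by the image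
`u = z̄/1 = reesChartBase z̄ _ z̄` of `z̄`. We prove that `u` is a UNIT of `A_z`
(`stub_e8ChartZUnit`): the `z`-chart contains no point of the exceptional divisor, so every
clause of the calibration quantified over the maximal ideals `Q ∋ u` of `A_z` is vacuous there.

Proof. In `R` we have `z̄² = -(x̄³ + ȳ⁵)`, hence `z̄ · w = 1` in `R[1/z̄]` for
`w = -(x̄/z̄)³ - z̄² (ȳ/z̄)⁵` (`mul_eq_one_of_rel`), and `w` lies in the affine blowup algebra
`R[𝔪/z̄] ⊆ R[1/z̄]` generated over `R` by the `c/z̄`, `c ∈ 𝔪` (`div_mem_blowupAlgebra`). The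
chart map `reesChart : A_z → R[1/z̄]` is injective with image `R[𝔪/z̄]` (`reesChart_injective`,
`range_reesChart`; Stacks 07Z3 (1)+(3)) and sends `u ↦ z̄/1`, so the pull-back of `w` along it
is an inverse of `u` in `A_z` (`isUnit_reesChartBase_of_mul_eq_one`).

References: folklore; The Stacks Project, Tag 0804 (blowing up is `Proj` of the Rees algebra,
`D₊(a⁽¹⁾) = Spec R[I/a]`) and Tag 07Z3 (`R[I/a] ⊆ R[1/a]`) for the chart rings.
-/

-- single-problem summit: the doubled namespace component is forced
set_option linter.dupNamespace false

noncomputable section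

namespace Summit.ResolutionOfSingularities.ResolutionOfSingularities.Theorems.FInjectiveMacaulayfication.E8ChartZUnit

open Literature.AlgebraicGeometry.Resolution

/-- If `a · w = 1` in `R[1/a]` for some `w` in the affine blowup algebra `R[I/a] ⊆ R[1/a]`, then
the image `a/1 = reesChartBase a ha a` of `a ∈ I` in the chart ring `(R[It])_{(at)}` of
`Bl_I(Spec R)` is a unit: the chart map `(R[It])_{(at)} → R[1/a]` is injective with image `R[I/a]`
and sends `a/1 ↦ a`, so the pull-back of `w` is an inverse of `a/1`. [folklore] -/
theorem isUnit_reesChartBase_of_mul_eq_one {R : Type*} [CommRing R] {I : Ideal R} (a : R)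
    (ha : a ∈ I) {w : Localization.Away a} (hw : w ∈ blowupAlgebra I a)
    (h : algebraMap R (Localization.Away a) a * w = 1) : IsUnit (reesChartBase a ha a) := by
  have hw' : w ∈ Set.range (reesChart a ha) := by
    rw [range_reesChart a ha]
    exact hw
  obtain ⟨w', rfl⟩ := hw'
  have hmul : reesChartBase a ha a * w' = 1 := by
    refine reesChart_injective a ha ?_
    rw [map_mul, map_one, reesChart_reesChartBase]
    exact h
  exact ⟨⟨reesChartBase a ha a, w', hmul, (mul_comm w' (reesChartBase a ha a)).trans hmul⟩, rfl⟩

/-- The polynomial identity behind the `z`-chart of `Bl_𝔪(E₈⁰)`: in a commutative ring, if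
`A t = 1` and `A² + B³ + C⁵ = 0`, then `A · (-(B t)³ - A² (C t)⁵) = 1`
(indeed `A · w = -(B³ + C⁵) t² = A² t² = 1`). [folklore] -/
theorem mul_eq_one_of_rel {L : Type*} [CommRing L] {A B C t : L} (hinv : A * t = 1)
    (hrel : A ^ 2 + B ^ 3 + C ^ 5 = 0) :
    A * (-(B * t) ^ 3 - A ^ 2 * (C * t) ^ 5) = 1 := by
  linear_combination (-t ^ 2) * hrel +
    (-B ^ 3 * t ^ 2 - (1 + A * t + A ^ 2 * t ^ 2) * C ^ 5 * t ^ 2 + A * t + 1) * hinv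

/-- CALIBRATION, `z`-chart (stub `stub_e8ChartZUnit` of line `Sketch`): for a field `k`,
`f = z² + x³ + y⁵`, `R = k[x, y, z]/(f)` and `𝔪 = (x̄, ȳ, z̄)`, the image `z̄/1` of `z̄` in the
chart ring `(R[𝔪t])_{(z̄t)} = R[𝔪/z̄]` of `Bl_𝔪(Spec R)` is a unit — the `z`-chart misses the
exceptional divisor — because `z̄ · (-(x̄/z̄)³ - z̄² (ȳ/z̄)⁵) = 1` in `R[1/z̄]` with the second
factor in `R[𝔪/z̄]`, the image of the injective chart map. [folklore] -/
theorem stub_e8ChartZUnit : ∀ (k : Type) [Field k] (f : MvPolynomial (Fin 3) k),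
    f = MvPolynomial.X 2 ^ 2 + MvPolynomial.X 0 ^ 3 + MvPolynomial.X 1 ^ 5 →
    ∀ (x : Fin 3 → MvPolynomial (Fin 3) k ⧸ Ideal.span {f}),
      x = (fun j : Fin 3 => Ideal.Quotient.mk (Ideal.span {f}) (MvPolynomial.X j)) →
      IsUnit (reesChartBase (x 2) (Ideal.subset_span (Set.mem_range_self 2)) (x 2)) := by
  intro k _ f hf x hx
  -- the relation `z̄² + x̄³ + ȳ⁵ = 0` in `R = k[x, y, z]/(f)`
  have hrelR : x 2 ^ 2 + x 0 ^ 3 + x 1 ^ 5 = 0 := by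
    have h0 : Ideal.Quotient.mk (Ideal.span {f})
        (MvPolynomial.X 2 ^ 2 + MvPolynomial.X 0 ^ 3 + MvPolynomial.X 1 ^ 5) = 0 :=
      Ideal.Quotient.eq_zero_iff_mem.mpr (by rw [← hf]; exact Ideal.mem_span_singleton_self f)
    subst hx
    simpa only [map_add, map_pow] using h0
  -- ... mapped to `R[1/z̄]`, together with `z̄ · (1/z̄) = 1`
  have hrelL := congrArg (algebraMap _ (Localization.Away (x 2))) hrelR
  simp only [map_add, map_pow, map_zero] at hrelL
  have hinv := IsLocalization.Away.mul_invSelf (S := Localization.Away (x 2)) (x 2)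
  -- `w = -(x̄/z̄)³ - z̄² (ȳ/z̄)⁵ ∈ R[𝔪/z̄]` is an inverse of `z̄` in `R[1/z̄]`; pull it back
  have h0 : x 0 ∈ Ideal.span (Set.range x) := Ideal.subset_span (Set.mem_range_self 0)
  have h1 : x 1 ∈ Ideal.span (Set.range x) := Ideal.subset_span (Set.mem_range_self 1)
  exact isUnit_reesChartBase_of_mul_eq_one (x 2) _
    (Subalgebra.sub_mem _
      (Subalgebra.neg_mem _ (Subalgebra.pow_mem _ (div_mem_blowupAlgebra _ (x 2) h0) 3))
      (Subalgebra.mul_mem _ (Subalgebra.pow_mem _ (Subalgebra.algebraMap_mem _ (x 2)) 2)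
        (Subalgebra.pow_mem _ (div_mem_blowupAlgebra _ (x 2) h1) 5)))
    (mul_eq_one_of_rel hinv hrelL)

end Summit.ResolutionOfSingularities.ResolutionOfSingularities.Theorems.FInjectiveMacaulayfication.E8ChartZUnit

end
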